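import Summits.Ventures.PercRepro.ProfileGapMonoGenericA

/-!
# PercRepro — THE GENERIC TEMPLATE, PART B: the supply injection and the template theorem (p5, gen 21;
`proofs/P5-GM1.md` §10; announced INBOX 9980; PART B OF THE SPLIT of ProfileGapMonoGeneric.lean (428 l., sha256
a8fb8240b5700d498dfc84e3038db2d29b966f9c5cf4b665be501a217f0f6dff), lines 225–428, bodies byte-identical; RULING (um)(64) / lint.size)

* `levelSetCoQ_delete_subset`, `rk_contract_le_rk`, `genMap`, `genMap_mem`, `genMap_injOn`,
  `card_levelSetCoQ_genericAt` — the supply side: `W⁻_{q−1}(M／z; u−1) + W⁻_q(M∖z; u) ≤ W⁻_q(M; u)`;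
* `mul_choose_pred_eq` — `u·C(u−1,q−1) = q·C(u,q)`;
* **`gapMonoQ_of_genericAt`** — the template; **`gapMonoQ_slack_of_genericAt`** — its quantitative form.
-/

open scoped Matroid

namespace PercRepro.Cogirth

open Finset ThmH Skew Shadow Profile

variable {α : Type} [DecidableEq α] {M : Matroid α} [M.Finite]

/-! ### The supply side -/

omit [DecidableEq α] in
/-- `eRk` from `ρ` (naturals). -/
theorem eRk_eq_of_rk_eq_gen {S : Finset α} {u : ℕ} (h : rk M S = u) : M.eRk (S : Set α) = (u : ℕ∞) := by
  rw [← coe_rk, h]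

omit [DecidableEq α] in
/-- `ρ` from `eRk`. -/
theorem rk_eq_of_eRk_eq_gen {S : Finset α} {u : ℕ} (h : M.eRk (S : Set α) = (u : ℕ∞)) : rk M S = u := by
  unfold rk; rw [h]; exact ENat.toNat_coe u

section Supply

variable {z : α} {q u : ℕ} (hz : z ∈ gr M) (hz1 : rk M {z} = 1) (hgen : GenericAt M z q)

/-- The co-rank-`q` rank-`u` sets of `M ∖ z` are co-rank-`q` rank-`u` sets of `M`. -/
theorem levelSetCoQ_delete_subset (z : α) (q u : ℕ) :
    levelSetCoQ (M ＼ ({z} : Set α)) q u ⊆ levelSetCoQ M q u := by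
  rw [levelSetCoQ_delete_eq_filter]; exact filter_subset _ _

include hz1 in
/-- `ρ_{M／z}(X) ≤ ρ_M(X)` for `X ⊆ E ∖ z`. -/
theorem rk_contract_le_rk {X : Finset α} (hX : X ⊆ (gr M).erase z) :
    rk (M ／ ({z} : Set α)) X ≤ rk M X := by
  have h := rk_contract_add_one (indep_singleton_of_rk_one hz1) hX
  have h2 : rk M (insert z X) ≤ rk M X + 1 := rk_insert_le z X
  omega

/-- The map of the supply injection: `insert z S'` when its `M`-complement still has rank `≥ q`, else `S'`
(a LOST set). -/
noncomputable def genMap (M : Matroid α) [M.Finite] (z : α) (q : ℕ) (S' : Finset α) : Finset α :=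
  if q ≤ rk M (gr M \ insert z S') then insert z S' else S'

include hz hz1 hgen in
/-- The injection lands in the co-rank-`q` rank-`u` sets of `M` that are not sets of `M ∖ z`. -/
theorem genMap_mem (hqu : q < u) (hR : u + q ≤ rk M (gr M) + 1) {S' : Finset α}
    (hS' : S' ∈ levelSetCoQ (M ／ ({z} : Set α)) (q - 1) (u - 1)) :
    genMap M z q S' ∈ levelSetCoQ M q u \ levelSetCoQ (M ＼ ({z} : Set α)) q u := by
  have hind := indep_singleton_of_rk_one hz1
  rw [mem_levelSetCoQ, gr_contract'] at hS'
  obtain ⟨⟨hSg, hSr⟩, hSc⟩ := hS'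
  have hSr' : rk (M ／ ({z} : Set α)) S' = u - 1 := rk_eq_of_eRk_eq_gen hSr
  have hzS : z ∉ S' := fun h => (mem_erase.1 (hSg h)).1 rfl
  have hSg' : S' ⊆ gr M := (subset_erase.1 hSg).1
  have hcon := rk_contract_add_one hind hSg
  have hrk : rk M (insert z S') = u := by omega
  have hcomp : gr M \ insert z S' = (gr M).erase z \ S' := by rw [sdiff_insert, erase_sdiff]
  have hsub : (gr M).erase z \ S' ⊆ (gr M).erase z := sdiff_subset
  have hins : insert z ((gr M).erase z \ S') = gr M \ S' := by
    rw [erase_sdiff, insert_erase (mem_sdiff.2 ⟨hz, hzS⟩)]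
  have hcon2 := rk_contract_add_one hind hsub
  rw [hins] at hcon2
  have hle := rk_contract_le_rk hz1 hsub
  have hnotdel : ∀ {S : Finset α}, z ∈ S → S ∉ levelSetCoQ (M ＼ ({z} : Set α)) q u := by
    intro S hzS hS
    rw [mem_levelSetCoQ, gr_delete'] at hS
    exact (mem_erase.1 (hS.1.1 hzS)).1 rfl
  unfold genMap
  split_ifs with hcase
  · rw [mem_sdiff, mem_levelSetCoQ]
    exact ⟨⟨⟨insert_subset hz hSg', eRk_eq_of_rk_eq_gen hrk⟩, hcase⟩, hnotdel (mem_insert_self z S')⟩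
  · -- the LOST case: the `M`-complement of `S'` has rank exactly `q`, `S'` has rank `u`
    rw [hcomp] at hcase
    have hq1 : rk M ((gr M).erase z \ S') = q - 1 := by omega
    have hcq : rk M (gr M \ S') = q := by omega
    have hRE : rk M ((gr M).erase z) = rk M (gr M) := rk_erase_of_genericAt hgen
    have hsm := rk_le_rk_add_rk_sdiff (M := M) S' ((gr M).erase z)
    rw [hRE] at hsm
    have hSu : rk M S' = u := by
      have h1 : rk M S' ≤ rk M (insert z S') := rk_mono_sub (subset_insert z S')
      omega
    rw [mem_sdiff, mem_levelSetCoQ]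
    refine ⟨⟨⟨hSg', eRk_eq_of_rk_eq_gen hSu⟩, by rw [hcq]⟩, ?_⟩
    intro hS
    rw [levelSetCoQ_delete_eq_filter, mem_filter, ← erase_sdiff] at hS
    omega

/-- The injection is injective on the co-rank-`(q−1)` rank-`(u−1)` sets of `M ／ z`. -/
theorem genMap_injOn :
    Set.InjOn (genMap M z q) ((levelSetCoQ (M ／ ({z} : Set α)) (q - 1) (u - 1) : Finset (Finset α)) :
      Set (Finset α)) := by
  intro S hS T hT h
  rw [mem_coe, mem_levelSetCoQ, gr_contract'] at hS hT
  have hzS : z ∉ S := fun hz' => (mem_erase.1 (hS.1.1 hz')).1 rfl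
  have hzT : z ∉ T := fun hz' => (mem_erase.1 (hT.1.1 hz')).1 rfl
  unfold genMap at h
  split_ifs at h with h1 h2 h2
  · rw [← erase_insert hzS, ← erase_insert hzT, h]
  · exact absurd (h ▸ mem_insert_self z S) hzT
  · exact absurd (h.symm ▸ mem_insert_self z T) hzS
  · exact h

include hz hz1 hgen in
/-- **The supply side**: `W⁻_{q−1}(M／z; u−1) + W⁻_q(M∖z; u) ≤ W⁻_q(M; u)`. -/
theorem card_levelSetCoQ_genericAt (hqu : q < u) (hR : u + q ≤ rk M (gr M) + 1) :
    (levelSetCoQ (M ／ ({z} : Set α)) (q - 1) (u - 1)).card + (levelSetCoQ (M ＼ ({z} : Set α)) q u).card ≤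
      (levelSetCoQ M q u).card := by
  have h1 : (levelSetCoQ (M ／ ({z} : Set α)) (q - 1) (u - 1)).card ≤
      (levelSetCoQ M q u \ levelSetCoQ (M ＼ ({z} : Set α)) q u).card :=
    card_le_card_of_injOn (genMap M z q) (fun S' hS' => by
      rw [mem_coe] at hS' ⊢; exact genMap_mem hz hz1 hgen hqu hR hS') genMap_injOn
  rw [card_sdiff_of_subset (levelSetCoQ_delete_subset z q u)] at h1
  have h2 := card_le_card (levelSetCoQ_delete_subset (M := M) z q u)
  omega

end Supply

/-! ### The template -/

/-- `u · C(u−1, q−1) = q · C(u, q)` for `1 ≤ q ≤ u`. -/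
theorem mul_choose_pred_eq {q u : ℕ} (hq : 1 ≤ q) (hqu : q ≤ u) :
    u * (u - 1).choose (q - 1) = q * u.choose q := by
  obtain ⟨u', rfl⟩ : ∃ u', u = u' + 1 := ⟨u - 1, by omega⟩
  obtain ⟨q', rfl⟩ : ∃ q', q = q' + 1 := ⟨q - 1, by omega⟩
  simp only [Nat.add_sub_cancel]
  rw [Nat.add_one_mul_choose_eq, Nat.mul_comm]

/-- **THE GENERIC TEMPLATE.**  At a `q`-generic point `z` with `u + q ≤ ρ(E) + 1`, the co-rank-`(q−1)` row of
`M ／ z` at level `u − 1` gives `(GM)_q` at `z`. -/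
theorem gapMonoQ_of_genericAt {z : α} {q u : ℕ} (hz : z ∈ gr M) (hz1 : rk M {z} = 1) (hgen : GenericAt M z q)
    (hq : 1 ≤ q) (hqu : q < u) (hR : u + q ≤ rk M (gr M) + 1)
    (h : ProfileIneqMinusQ (M ／ ({z} : Set α)) (q - 1) (u - 1)) : GapMonoQ M z q u := by
  unfold GapMonoQ
  rw [sum_demand_genericAt hz hgen hz1 hq]
  unfold ProfileIneqMinusQ at h
  set N := M ／ ({z} : Set α) with hN
  set T := ∑ B' ∈ Rq N (q - 1), (if u ≤ rk N (gr N \ B') + 1 then (rk N (gr N \ B') + 1).choose (u - q) else 0)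
    with hT
  set DN := ∑ B ∈ Rq N (q - 1), demand N (q - 1) (u - 1) B with hDN
  set WN := (levelSetCoQ N (q - 1) (u - 1)).card with hWN
  set W' := (levelSetCoQ (M ＼ ({z} : Set α)) q u).card with hW'
  set W := (levelSetCoQ M q u).card with hW
  set D' := ∑ B ∈ Rq (M ＼ ({z} : Set α)) q, demand (M ＼ ({z} : Set α)) q u B with hD'
  -- termwise: `q · T ≤ u · DN`
  have hqT : q * T ≤ u * DN := by
    rw [hT, hDN, Finset.mul_sum, Finset.mul_sum]
    refine sum_le_sum (fun B' _ => ?_)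
    unfold demand
    have hsub : (u - 1) - (q - 1) = u - q := by omega
    rw [hsub]
    split_ifs with h1 h2 h2
    · exact choose_succ_mul_le_gen hq hqu (by omega)
    · omega
    · omega
    · simp
  -- the row of `N`: `DN ≤ C(u−1, q−1) · WN`; so `q · T ≤ u · C(u−1,q−1) · WN = q · C(u,q) · WN`
  have hTW : T ≤ u.choose q * WN := by
    have h3 : q * T ≤ q * (u.choose q * WN) := by
      calc q * T ≤ u * DN := hqT
        _ ≤ u * ((u - 1).choose (q - 1) * WN) := Nat.mul_le_mul_left u h
        _ = (u * (u - 1).choose (q - 1)) * WN := by ring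
        _ = (q * u.choose q) * WN := by rw [mul_choose_pred_eq hq hqu.le]
        _ = q * (u.choose q * WN) := by ring
    exact Nat.le_of_mul_le_mul_left h3 (by omega)
  have hsupply : WN + W' ≤ W := card_levelSetCoQ_genericAt hz hz1 hgen hqu hR
  calc D' + T + u.choose q * W' ≤ D' + u.choose q * WN + u.choose q * W' := by omega
    _ = D' + u.choose q * (WN + W') := by ring
    _ ≤ D' + u.choose q * W := by
        have := Nat.mul_le_mul_left (u.choose q) hsupply; omega

/-- **The quantitative template**: at a `q`-generic point with `u + q ≤ ρ(E) + 1`, the deletion difference of the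
co-rank-`q` gap exceeds `(u/q)` times the co-rank-`(q−1)` gap of `M ／ z` at level `u − 1` — in ℕ without
subtraction: `q·(D(M∖z) + C(u,q)·W⁻(M)) + u·D_{q−1}(M／z) ≥ q·(D(M) + C(u,q)·W⁻(M∖z)) + u·C(u−1,q−1)·W⁻_{q−1}(M／z)`. -/
theorem gapMonoQ_slack_of_genericAt {z : α} {q u : ℕ} (hz : z ∈ gr M) (hz1 : rk M {z} = 1)
    (hgen : GenericAt M z q) (hq : 1 ≤ q) (hqu : q < u) (hR : u + q ≤ rk M (gr M) + 1) :
    q * (∑ B ∈ Rq M q, demand M q u B + u.choose q * (levelSetCoQ (M ＼ ({z} : Set α)) q u).card) +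
        u * ((u - 1).choose (q - 1) * (levelSetCoQ (M ／ ({z} : Set α)) (q - 1) (u - 1)).card) ≤
      q * (∑ B ∈ Rq (M ＼ ({z} : Set α)) q, demand (M ＼ ({z} : Set α)) q u B +
          u.choose q * (levelSetCoQ M q u).card) +
        u * ∑ B ∈ Rq (M ／ ({z} : Set α)) (q - 1), demand (M ／ ({z} : Set α)) (q - 1) (u - 1) B := by
  rw [sum_demand_genericAt hz hgen hz1 hq]
  set N := M ／ ({z} : Set α) with hN
  set T := ∑ B' ∈ Rq N (q - 1), (if u ≤ rk N (gr N \ B') + 1 then (rk N (gr N \ B') + 1).choose (u - q) else 0)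
    with hT
  set DN := ∑ B ∈ Rq N (q - 1), demand N (q - 1) (u - 1) B with hDN
  set WN := (levelSetCoQ N (q - 1) (u - 1)).card with hWN
  set W' := (levelSetCoQ (M ＼ ({z} : Set α)) q u).card with hW'
  set W := (levelSetCoQ M q u).card with hW
  set D' := ∑ B ∈ Rq (M ＼ ({z} : Set α)) q, demand (M ＼ ({z} : Set α)) q u B with hD'
  have hqT : q * T ≤ u * DN := by
    rw [hT, hDN, Finset.mul_sum, Finset.mul_sum]
    refine sum_le_sum (fun B' _ => ?_)
    unfold demand
    have hsub : (u - 1) - (q - 1) = u - q := by omega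
    rw [hsub]
    split_ifs with h1 h2 h2
    · exact choose_succ_mul_le_gen hq hqu (by omega)
    · omega
    · omega
    · simp
  have hsupply : WN + W' ≤ W := card_levelSetCoQ_genericAt hz hz1 hgen hqu hR
  have hC : u * (u - 1).choose (q - 1) = q * u.choose q := mul_choose_pred_eq hq hqu.le
  have h1 : u * ((u - 1).choose (q - 1) * WN) = q * (u.choose q * WN) := by
    rw [← Nat.mul_assoc, hC, Nat.mul_assoc]
  have h2 : q * (u.choose q * WN) + q * (u.choose q * W') ≤ q * (u.choose q * W) := by
    rw [← Nat.mul_add, ← Nat.mul_add]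
    exact Nat.mul_le_mul_left _ (Nat.mul_le_mul_left _ hsupply)
  calc q * (D' + T + u.choose q * W') + u * ((u - 1).choose (q - 1) * WN)
      = q * D' + q * T + q * (u.choose q * W') + q * (u.choose q * WN) := by rw [h1]; ring
    _ ≤ q * D' + u * DN + q * (u.choose q * W) := by omega
    _ = q * (D' + u.choose q * W) + u * DN := by ring

end PercRepro.Cogirth
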